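import Summits.RiemannHypothesis.RiemannHypothesis.Theorems.IntegerScrewCensusDualPoly

/-!
# Route `IntegerScrew` — kernel checker for the census DUAL certificates (3b): soundness of the adaptive walk

ABSTRACT soundness of `walkGo` (`IntegerScrewCensusDualWalk`): if a real function `g` with companions `g₁, g₂` satisfies
the one-sided third-order Taylor inequality `g(τ+u) ≥ g(τ) + g₁(τ)u + ½g₂(τ)u² − Λu³` (`0 ≤ u ≤ 1/16`) and the three
Horner values bound `K·g, K·g₁, K·g₂` from below at the dyadic points up to the offsets and slacks, then
`walkGo … = true` (started at `m < mend`) gives `g ≥ 0` on `[m/M, mend/M]`.  RH-free; nothing here bears on the truth of RH.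
-/

set_option linter.dupNamespace false
set_option autoImplicit false

namespace Summit.RiemannHypothesis.RiemannHypothesis.Theorems.IntegerScrew.Manifest.Fast

open Finset

/-! ### Soundness of the walk (abstract) -/

/-- What `stepFind` returns: a step `2^{R−r}` from the menu that fits and passes the test. -/
theorem stepFind_spec (A0 B1 B2 Lam m mend : ℕ) : ∀ (rs : List ℕ) (st : ℕ), stepFind A0 B1 B2 Lam m mend rs = some st →
    ∃ r ∈ rs, st = 2 ^ (RB - r) ∧ m + st ≤ mend ∧ 2 * 4 ^ r * B1 + 2 ^ r * B2 + 2 * Lam ≤ 2 * 8 ^ r * A0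
  | [], st, h => by simp [stepFind] at h
  | r :: rs, st, h => by
    simp only [stepFind] at h
    split_ifs at h with hc
    · refine ⟨r, by simp, ?_, hc.1.trans_eq' ?_, hc.2⟩
      · simpa using h.symm
      · simp_all
    · obtain ⟨r', hr', hrest⟩ := stepFind_spec A0 B1 B2 Lam m mend rs st h
      exact ⟨r', List.mem_cons_of_mem _ hr', hrest⟩

/-- The menu steps are at most `1/16` of the cell: `r ≥ 4`. -/
theorem rMenu_ge {r : ℕ} (h : r ∈ rMenu) : 4 ≤ r ∧ r ≤ RB := by
  unfold rMenu at h
  rw [List.mem_map] at h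
  obtain ⟨i, hi, rfl⟩ := h
  rw [List.mem_range] at hi
  unfold RB at hi ⊢
  omega

/-- One accepted step: from the lower bounds at `τ = m/M` and the test, `g ≥ 0` on `[m/M, (m + 2^{R−r})/M]`. -/
theorem step_nonneg {g g1 g2 : ℝ → ℝ} {K Lr : ℝ} {A0 B1 B2 Lam r : ℕ} (hK : 0 < K) (hr : 4 ≤ r) (hrR : r ≤ RB)
    {τ : ℝ} (htaylor : ∀ u : ℝ, 0 ≤ u → u ≤ 1 / 16 → g τ + g1 τ * u + g2 τ / 2 * u ^ 2 - Lr * u ^ 3 ≤ g (τ + u))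
    (hLam : K * Lr ≤ Lam) (h0 : (A0 : ℝ) ≤ K * g τ) (h1 : -(B1 : ℝ) ≤ K * g1 τ) (h2 : -(B2 : ℝ) ≤ K * g2 τ)
    (htest : 2 * 4 ^ r * B1 + 2 ^ r * B2 + 2 * Lam ≤ 2 * 8 ^ r * A0) :
    ∀ u : ℝ, 0 ≤ u → u ≤ (2 : ℝ) ^ (RB - r) / MR → 0 ≤ g (τ + u) := by
  intro u hu0 hu1
  have hη : (2 : ℝ) ^ (RB - r) / MR = 1 / 2 ^ r := by
    have hMR : ((MR : ℕ) : ℝ) = 2 ^ RB := by norm_num [MR, RB]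
    rw [hMR, div_eq_div_iff (by positivity) (by positivity), one_mul, ← pow_add, Nat.sub_add_cancel hrR]
  rw [hη] at hu1
  have hu16 : u ≤ 1 / 16 := hu1.trans (by
    rw [div_le_div_iff₀ (by positivity) (by norm_num), one_mul, one_mul]
    calc (16 : ℝ) = 2 ^ 4 := by norm_num
      _ ≤ 2 ^ r := pow_le_pow_right₀ (by norm_num) hr)
  have ht := htaylor u hu0 hu16
  -- K·g(τ+u) ≥ A0 − B1 u − (B2/2) u² − Lam u³ ≥ A0 − B1 η − (B2/2) η² − Lam η³ ≥ 0
  have hKg : K * g (τ + u) ≥ (A0 : ℝ) - B1 * u - (B2 : ℝ) / 2 * u ^ 2 - (Lam : ℝ) * u ^ 3 := by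
    have e1 : K * (g τ + g1 τ * u + g2 τ / 2 * u ^ 2 - Lr * u ^ 3) ≤ K * g (τ + u) :=
      mul_le_mul_of_nonneg_left ht hK.le
    have e2 : K * g1 τ * u ≥ -(B1 : ℝ) * u := mul_le_mul_of_nonneg_right h1 hu0
    have e3 : K * g2 τ / 2 * u ^ 2 ≥ -(B2 : ℝ) / 2 * u ^ 2 := by
      have := mul_le_mul_of_nonneg_right h2 (by positivity : (0 : ℝ) ≤ u ^ 2 / 2)
      linarith
    have e4 : K * Lr * u ^ 3 ≤ (Lam : ℝ) * u ^ 3 := mul_le_mul_of_nonneg_right hLam (by positivity)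
    nlinarith
  set η : ℝ := 1 / 2 ^ r with hηdef
  have hη0 : 0 ≤ η := by positivity
  have hB1 : (B1 : ℝ) * u ≤ B1 * η := mul_le_mul_of_nonneg_left hu1 (by positivity)
  have hB2 : (B2 : ℝ) / 2 * u ^ 2 ≤ (B2 : ℝ) / 2 * η ^ 2 :=
    mul_le_mul_of_nonneg_left (pow_le_pow_left₀ hu0 hu1 2) (by positivity)
  have hL : (Lam : ℝ) * u ^ 3 ≤ (Lam : ℝ) * η ^ 3 := mul_le_mul_of_nonneg_left (pow_le_pow_left₀ hu0 hu1 3) (by positivity)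
  have htest' : (2 * 4 ^ r * B1 + 2 ^ r * B2 + 2 * Lam : ℝ) ≤ 2 * 8 ^ r * A0 := by exact_mod_cast htest
  have h8 : (8 : ℝ) ^ r * η ^ 3 = 1 := by rw [hηdef, div_pow, one_pow, ← pow_mul, show (8:ℝ) = 2 ^ 3 by norm_num, ← pow_mul]; field_simp; ring_nf
  have h4 : (4 : ℝ) ^ r * η ^ 2 = 1 := by rw [hηdef, div_pow, one_pow, show (4:ℝ) = 2 ^ 2 by norm_num, ← pow_mul, ← pow_mul]; field_simp; ring_nf
  have h2' : (2 : ℝ) ^ r * η = 1 := by rw [hηdef]; field_simp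
  -- multiply the target by 2·8^r η³ = 2
  have key : (A0 : ℝ) - B1 * η - (B2 : ℝ) / 2 * η ^ 2 - Lam * η ^ 3 ≥ 0 := by
    have hpos8 : (0 : ℝ) < 8 ^ r := by positivity
    have : (2 * 8 ^ r : ℝ) * ((A0 : ℝ) - B1 * η - (B2 : ℝ) / 2 * η ^ 2 - Lam * η ^ 3) =
        2 * 8 ^ r * A0 - (2 * 4 ^ r * B1) * (2 ^ r * η) - (2 ^ r * B2) * (4 ^ r * η ^ 2) - 2 * Lam * (8 ^ r * η ^ 3) := by
      have e8 : (8 : ℝ) ^ r = 2 ^ r * 4 ^ r := by rw [← mul_pow]; norm_num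
      rw [e8]; ring
    rw [h8, h4, h2', mul_one, mul_one, mul_one] at this
    nlinarith
  have : K * g (τ + u) ≥ 0 := by linarith
  exact (mul_nonneg_iff_of_pos_left hK).mp this

/-- **Soundness of the walk.**  If at every dyadic point `m < mend` the Horner values bound `K·g`, `K·g₁`, `K·g₂` from below
up to the offsets and slacks, and `g` satisfies the one-sided third-order Taylor inequality with `K·Λr ≤ Lam`, then
`walkGo … fuel m = true` (started at `m < mend`) gives `g ≥ 0` on `[m/M, mend/M]`. -/
theorem walk_sound {g g1 g2 : ℝ → ℝ} {K Lr : ℝ} (hK : 0 < K) {c0 c1 c2 : List ℕ} {C0 C1 C2 S0 S1 S2 Lam D mend : ℕ}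
    (htaylor : ∀ τ u : ℝ, 0 ≤ u → u ≤ 1 / 16 → g τ + g1 τ * u + g2 τ / 2 * u ^ 2 - Lr * u ^ 3 ≤ g (τ + u))
    (hLam : K * Lr ≤ Lam)
    (h0 : ∀ m : ℕ, m < mend → ((hornerR m c0 : ℕ) : ℝ) - C0 * (geoSum D m : ℕ) - S0 ≤ K * g ((m : ℝ) / MR))
    (h1 : ∀ m : ℕ, m < mend → ((hornerR m c1 : ℕ) : ℝ) - C1 * (geoSum D m : ℕ) - S1 ≤ K * g1 ((m : ℝ) / MR))
    (h2 : ∀ m : ℕ, m < mend → ((hornerR m c2 : ℕ) : ℝ) - C2 * (geoSum D m : ℕ) - S2 ≤ K * g2 ((m : ℝ) / MR)) :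
    ∀ (fuel m : ℕ), walkGo c0 c1 c2 C0 C1 C2 S0 S1 S2 Lam D mend fuel m = true → m < mend →
      ∀ τ : ℝ, (m : ℝ) / MR ≤ τ → τ ≤ (mend : ℝ) / MR → 0 ≤ g τ := by
  intro fuel
  induction fuel with
  | zero =>
    intro m h hm
    simp only [walkGo, decide_eq_true_eq] at h
    omega
  | succ fuel ih =>
    intro m h hm τ hτ1 hτ2
    have hM : (0 : ℝ) < MR := by norm_num [MR]
    unfold walkGo at h
    rw [if_neg (by omega)] at h
    simp only at h
    split_ifs at h with hlt
    split at h
    · exact absurd h Bool.false_ne_true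
    · rename_i st hst
      obtain ⟨r, hr, hst_eq, hfit, htest⟩ := stepFind_spec _ _ _ _ _ _ _ _ hst
      obtain ⟨hr4, hrR⟩ := rMenu_ge hr
      -- the bounds at the point `m`
      have hA0 : ((Nat.sub (hornerR m c0) (Nat.add (Nat.mul C0 (geoSum D m)) S0) : ℕ) : ℝ) ≤ K * g ((m : ℝ) / MR) := by
        have hle : Nat.add (Nat.mul C0 (geoSum D m)) S0 ≤ hornerR m c0 := Nat.le_of_not_lt hlt
        rw [Nat.sub_eq, Nat.cast_sub hle]
        simp only [Nat.add_eq, Nat.mul_eq]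
        push_cast
        linarith [h0 m hm]
      have hB1 : -((Nat.sub (Nat.add S1 (Nat.mul C1 (geoSum D m))) (hornerR m c1) : ℕ) : ℝ) ≤ K * g1 ((m : ℝ) / MR) := by
        have := h1 m hm
        simp only [Nat.sub_eq, Nat.add_eq, Nat.mul_eq]
        have hz : ((S1 + C1 * geoSum D m : ℕ) : ℝ) - (hornerR m c1 : ℕ) ≤ ((S1 + C1 * geoSum D m - hornerR m c1 : ℕ) : ℝ) := by
          have := (Int.cast_le (R := ℝ)).2 (show ((S1 + C1 * geoSum D m : ℕ) : ℤ) - (hornerR m c1 : ℕ) ≤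
            ((S1 + C1 * geoSum D m - hornerR m c1 : ℕ) : ℤ) by omega)
          push_cast at this ⊢; exact this
        push_cast at hz ⊢
        linarith
      have hB2 : -((Nat.sub (Nat.add S2 (Nat.mul C2 (geoSum D m))) (hornerR m c2) : ℕ) : ℝ) ≤ K * g2 ((m : ℝ) / MR) := by
        have := h2 m hm
        simp only [Nat.sub_eq, Nat.add_eq, Nat.mul_eq]
        have hz : ((S2 + C2 * geoSum D m : ℕ) : ℝ) - (hornerR m c2 : ℕ) ≤ ((S2 + C2 * geoSum D m - hornerR m c2 : ℕ) : ℝ) := by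
          have := (Int.cast_le (R := ℝ)).2 (show ((S2 + C2 * geoSum D m : ℕ) : ℤ) - (hornerR m c2 : ℕ) ≤
            ((S2 + C2 * geoSum D m - hornerR m c2 : ℕ) : ℤ) by omega)
          push_cast at this ⊢; exact this
        push_cast at hz ⊢
        linarith
      have hstep := step_nonneg (τ := (m : ℝ) / MR) hK hr4 hrR (htaylor _) hLam hA0 hB1 hB2 htest
      by_cases hτ : τ ≤ ((m + st : ℕ) : ℝ) / MR
      · have hu := hstep (τ - (m : ℝ) / MR) (by linarith) (by
          rw [hst_eq] at hτ; push_cast at hτ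
          have : τ - (m : ℝ) / MR ≤ ((m : ℝ) + 2 ^ (RB - r)) / MR - (m : ℝ) / MR := by linarith
          rw [← sub_div] at this; simpa using this)
        simpa using hu
      · push_cast at hτ
        have hm' : m + st < mend := by
          by_contra hc
          have : (mend : ℝ) ≤ (m : ℝ) + st := by exact_mod_cast Nat.le_of_not_lt hc
          have : (mend : ℝ) / MR ≤ ((m : ℝ) + st) / MR := by gcongr
          exact hτ (hτ2.trans this)
        exact ih (m + st) h hm' τ (by push_cast; linarith [le_of_lt (lt_of_not_ge hτ)]) hτ2

end Summit.RiemannHypothesis.RiemannHypothesis.Theorems.IntegerScrew.Manifest.Fast
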